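import Summits.Langlands.Langlands.Theorems.IrreducibilityBySelfDualityReciprocityUpToIrreducibilityAboveUnramified
import Literature.NumberTheory.Automorphic.LocalLanglandsGLOne
import Literature.NumberTheory.Automorphic.AutomorphicTwistSatake
import Literature.NumberTheory.Automorphic.AdicCompletionLocalField
import Literature.NumberTheory.GaloisRepresentations.LocalClassFieldTheoryProofs
import HarnessLib

/-!
# Line `Sketch` for the crux `ReciprocityUpToIrreducibility` (item stmt-Langlands-14328), continuation c4:
# the local component of a `GL₁` datum at an unramified place of its Hecke character

Support file (closes nothing; registered stub `stub_rankOne_hasLocalComponentAt_of_isUnramifiedAt` of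
line `Sketch`, continuation lead c4, prover-line-stmt-Langlands-14328-c4-0, §1f "rank one:
local–global compatibility at the unramified places of a Hecke character").

Let `π = W/W'` be a Borel–Jacquet datum of `GL₁(𝔸_K)` on which `GL₁(𝔸_K)` acts through the Hecke
character `χ ∘ det` modulo `W'` (`R(g) φ - χ(det g) φ ∈ W'` for `φ ∈ W`), and let `v` be a finite
place at which `χ` is unramified (`HeckeCharacter.IsUnramifiedAt`: the local component
`χ_v = χ ∘ (K_vˣ ↪ 𝕀_K)` kills `𝒪_vˣ`).  This file proves:

* `exists_unitsMap_eq_of_mem_unitGroup` — the bridge between the two unit groups of `K_v`: an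
  element of the unit group of the valuation ring of the local-field valuation
  `ValuativeRel.valuation K_v` (the vocabulary of `LocalArtinData.image_inertia`) is the image of a
  unit of `𝒪_v = v.adicCompletionIntegers K` (the vocabulary of `HeckeCharacter.IsUnramifiedAt`);
  the two valuations of `K_v` are equivalent (`ValuativeRel.isEquiv`, the valuative relation of
  `K_v` being that of `Valued.v`, `AdicCompletionLocalField`).
* `localComponent_eq_one_of_mem_unitGroup`, `continuous_localComponent_of_isUnramifiedAt` — at an
  unramified place `χ_v` kills the (open, `isOpen_unitGroup`) unit group, hence is continuous
  (`continuous_monoidHom_of_isOpen_ker`), i.e. is a quasi-character of `K_vˣ`.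
* `hasLocalComponentAt_ofQuasiChar` — for ANY quasi-character `χv` of `K_vˣ` agreeing with `χ_v`,
  `π` has local component `χv ∘ det` at `v` (Flath in rank one, explicit: the line `c ↦ c φ` for
  any `φ ∈ W ∖ W'` is a local component map, since `det (ι_v g) = (det g)_v`, `GLn.det_ofLocal`).
* `stub_rankOne_hasLocalComponentAt_of_isUnramifiedAt` — the registered stub, assembling the three.

No definitions; standard axioms only.
-/

noncomputable section

set_option linter.dupNamespace false -- project-wide option (lakefile weak.linter.dupNamespace); `Summit.Langlands.Langlands` is the mandated namespace

open scoped MatrixGroups Matrix NumberField Classical Polynomial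
open Filter IsDedekindDomain Field Polynomial
open Literature.NumberTheory.Automorphic Literature.NumberTheory.GaloisRepresentations
open Literature.NumberTheory.PAdicHodge
open Summit.Langlands

namespace Summit.Langlands.Langlands.Theorems.ReciprocityUpToIrreducibility

section RankOne

variable {K : Type} [Field K] [NumberField K]

/-- **The two unit groups of `K_v` agree.**  An element of the unit group of the valuation ring
of the local-field valuation `ValuativeRel.valuation K_v` is (the image in `K_vˣ` of) a unit of
`𝒪_v = v.adicCompletionIntegers K`: `ValuativeRel.valuation K_v` and `Valued.v` are equivalent
valuations of `K_v` (`ValuativeRel.isEquiv`; the valuative relation of `K_v` is the one of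
`Valued.v`), so `u` and `u⁻¹` have `Valued.v`-valuation `1 ≤ 1`.
[cite: SerreLocalFields1979, Ch. II §1] -/
theorem exists_unitsMap_eq_of_mem_unitGroup (v : HeightOneSpectrum (𝓞 K))
    {u : (v.adicCompletion K)ˣ}
    (hu : u ∈ (ValuativeRel.valuation (v.adicCompletion K)).valuationSubring.unitGroup) :
    ∃ u₀ : (v.adicCompletionIntegers K)ˣ,
      Units.map ((v.adicCompletionIntegers K).subtype : _ →* _) u₀ = u := by
  rw [Valuation.mem_unitGroup_iff, ← (ValuativeRel.isEquiv
    (Valued.v : Valuation (v.adicCompletion K) _)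
    (ValuativeRel.valuation (v.adicCompletion K))).eq_one_iff_eq_one] at hu
  have h1 : (u : v.adicCompletion K) ∈ v.adicCompletionIntegers K := by
    rw [HeightOneSpectrum.mem_adicCompletionIntegers, hu]
  have h2 : ((u⁻¹ : (v.adicCompletion K)ˣ) : v.adicCompletion K) ∈ v.adicCompletionIntegers K := by
    rw [HeightOneSpectrum.mem_adicCompletionIntegers, Units.val_inv_eq_inv_val, map_inv₀, hu, inv_one]
  exact ⟨⟨⟨_, h1⟩, ⟨_, h2⟩, Subtype.ext u.mul_inv, Subtype.ext u.inv_mul⟩, Units.ext rfl⟩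

/-- **At an unramified place the local component `χ_v` kills the unit group** of the valuation
ring of `K_v` (it kills `𝒪_vˣ` by definition of `IsUnramifiedAt`, and the two unit groups agree,
`exists_unitsMap_eq_of_mem_unitGroup`). [cite: TateThesis1967, §2.3] -/
theorem localComponent_eq_one_of_mem_unitGroup {χ : HeckeCharacter K} {v : HeightOneSpectrum (𝓞 K)}
    (hχ : χ.IsUnramifiedAt v) {u : (v.adicCompletion K)ˣ}
    (hu : u ∈ (ValuativeRel.valuation (v.adicCompletion K)).valuationSubring.unitGroup) :
    χ.localComponent v u = 1 := by
  obtain ⟨u₀, rfl⟩ := exists_unitsMap_eq_of_mem_unitGroup v hu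
  exact hχ u₀

/-- **At an unramified place the local component `χ_v : K_vˣ →* ℂˣ` is continuous**: its kernel
contains the unit group of `K_v` (`localComponent_eq_one_of_mem_unitGroup`), an open subgroup
(`isOpen_unitGroup`), and a homomorphism of topological groups with open kernel is continuous
(`continuous_monoidHom_of_isOpen_ker`). [cite: TateThesis1967, §2.3] -/
theorem continuous_localComponent_of_isUnramifiedAt {χ : HeckeCharacter K}
    {v : HeightOneSpectrum (𝓞 K)} (hχ : χ.IsUnramifiedAt v) :
    Continuous (χ.localComponent v) :=
  continuous_monoidHom_of_isOpen_ker _ (Subgroup.isOpen_mono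
    (fun _ hu => (MonoidHom.mem_ker).2 (localComponent_eq_one_of_mem_unitGroup hχ hu))
    isOpen_unitGroup)

variable {hcpt : isCompact_glFiniteIntegralLevel 1 K}

/-- **The local component of a `GL₁` datum acted on by `χ ∘ det` is `χ_v ∘ det`** (Flath in rank
one, explicit).  If `GL₁(𝔸_K)` acts on `π = W/W'` through `χ ∘ det` modulo `W'` and `χv` is a
quasi-character of `K_vˣ` agreeing with the local component `χ_v = χ ∘ (K_vˣ ↪ 𝕀_K)`, then `π`
has local component `χv ∘ det` (`SmoothIrrep.ofQuasiChar χv`) at `v`: for any `φ ∈ W ∖ W'`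
(`W' < W`) the line `f : c ↦ c φ` has `range f = ℂ φ ≤ W`, `range f ≰ W'`, and
`f (χv(det g) x) - R(ι_v g) (f x) = -x (R(ι_v g) φ - χ((det g)_v) φ) ∈ W'` because
`det (ι_v g) = (det g)_v` (`GLn.det_ofLocal`). [cite: FlathCorvallis1979, Thm. 3]
[cite: BorelJacquetCorvallis1979, §4.6] -/
theorem hasLocalComponentAt_ofQuasiChar
    (π : AutomorphicRepData (AutomorphyDatum.gl 1 K hcpt)) (χ : HeckeCharacter K)
    (hact : ∀ (g : (AdelicGroupData.gl 1 K).Adelic), ∀ φ ∈ π.W,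
      rightTranslation (AdelicGroupData.gl 1 K) g φ -
        ((χ (Matrix.GeneralLinearGroup.det g) : ℂˣ) : ℂ) • φ ∈ π.W')
    (v : HeightOneSpectrum (𝓞 K)) (χv : QuasiChar (v.adicCompletion K))
    (hχv : ∀ u : (v.adicCompletion K)ˣ, χv u = χ.localComponent v u) :
    π.HasLocalComponentAt v (SmoothIrrep.ofQuasiChar χv).ρ := by
  obtain ⟨φ, hφW, hφW'⟩ := SetLike.exists_of_lt π.lt
  show π.HasLocalComponentAt v (V := ℂ)
    (glOneRep (χv : (v.adicCompletion K)ˣ →* ℂˣ))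
  refine ⟨LinearMap.toSpanSingleton ℂ ((AdelicGroupData.gl 1 K).Adelic → ℂ) φ, ?_, ?_, fun g x => ?_⟩
  · rw [← LinearMap.span_singleton_eq_range, Submodule.span_singleton_le_iff_mem]
    exact hφW
  · intro hle
    refine hφW' (?_ : φ ∈ π.W')
    have h := hle (LinearMap.mem_range_self _ (1 : ℂ))
    rwa [LinearMap.toSpanSingleton_apply_one] at h
  · have hW' := hact (GLn.ofLocal 1 K v g) φ hφW
    rw [GLn.det_ofLocal, ← HeckeCharacter.localComponent_apply, ← hχv] at hW'
    have key : LinearMap.toSpanSingleton ℂ ((AdelicGroupData.gl 1 K).Adelic → ℂ) φ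
          (glOneRep (χv : (v.adicCompletion K)ˣ →* ℂˣ) g x) -
        rightTranslation (AdelicGroupData.gl 1 K) (GLn.ofLocal 1 K v g)
          (LinearMap.toSpanSingleton ℂ ((AdelicGroupData.gl 1 K).Adelic → ℂ) φ x) =
        -(x • (rightTranslation (AdelicGroupData.gl 1 K) (GLn.ofLocal 1 K v g) φ -
          ((χv (Matrix.GeneralLinearGroup.det g) : ℂˣ) : ℂ) • φ)) := by
      rw [LinearMap.toSpanSingleton_apply, LinearMap.toSpanSingleton_apply, map_smul,
        glOneRep_apply, smul_sub, neg_sub, smul_smul, mul_smul, mul_comm, mul_smul]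
      rfl
    rw [key]
    exact π.W'.neg_mem (π.W'.smul_mem x hW')

end RankOne

/-- **Registered stub `stub_rankOne_hasLocalComponentAt_of_isUnramifiedAt` of line `Sketch` (crux
stmt-Langlands-14328, c4 wave 2, automorphic): the local component of a `GL₁` datum at an
unramified place of its Hecke character.**  If `GL₁(𝔸_K)` acts on `π = W/W'` through `χ ∘ det`
(modulo `W'`) and `χ` is unramified at `v`, then the local component `χ_v = χ ∘ (K_vˣ ↪ 𝕀_K)` is a
quasi-character of `K_vˣ` (continuous: `continuous_localComponent_of_isUnramifiedAt`) trivial on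
the unit group `𝒪_vˣ` of `K_v` (`localComponent_eq_one_of_mem_unitGroup`), and `π` has local
component `χ_v ∘ det` at `v` (`hasLocalComponentAt_ofQuasiChar`: `φ ↦ ℂ φ` for any `φ ∈ W ∖ W'`,
`det ∘ ι_v = (det ·)_v`). [cite: FlathCorvallis1979, Thm. 3] [cite: TateThesis1967, §4.3] -/
theorem stub_rankOne_hasLocalComponentAt_of_isUnramifiedAt :
    ∀ (K : Type) [Field K] [NumberField K] (hcpt : isCompact_glFiniteIntegralLevel 1 K)
      (π : AutomorphicRepData (AutomorphyDatum.gl 1 K hcpt)) (χ : HeckeCharacter K),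
      (∀ (g : (AdelicGroupData.gl 1 K).Adelic), ∀ φ ∈ π.W,
        rightTranslation (AdelicGroupData.gl 1 K) g φ -
          ((χ (Matrix.GeneralLinearGroup.det g) : ℂˣ) : ℂ) • φ ∈ π.W') →
      ∀ v : HeightOneSpectrum (𝓞 K), χ.IsUnramifiedAt v →
        ∃ χv : QuasiChar (v.adicCompletion K),
          (∀ u : (v.adicCompletion K)ˣ, χv u = χ.localComponent v u) ∧
          (∀ u : (v.adicCompletion K)ˣ,
            u ∈ (ValuativeRel.valuation (v.adicCompletion K)).valuationSubring.unitGroup → χv u = 1) ∧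
          π.HasLocalComponentAt v (SmoothIrrep.ofQuasiChar χv).ρ := by
  intro K _ _ hcpt π χ hact v hχ
  let χv : QuasiChar (v.adicCompletion K) :=
    { toMonoidHom := χ.localComponent v
      continuous_toFun := continuous_localComponent_of_isUnramifiedAt hχ }
  have hχv : ∀ u : (v.adicCompletion K)ˣ, χv u = χ.localComponent v u := fun _ => rfl
  exact ⟨χv, hχv, fun u hu => (hχv u).trans (localComponent_eq_one_of_mem_unitGroup hχ hu),
    hasLocalComponentAt_ofQuasiChar π χ hact v χv hχv⟩

end Summit.Langlands.Langlands.Theorems.ReciprocityUpToIrreducibility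

end
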